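import Summits.MatrixMultiplication.MatrixMultiplication.Theses.DefinableSTPPDichotomy

/-!
# `DefinableSTPPDichotomy.HexagonClearanceR` — lemmas for stub `stub_radicalNormalForm` (line `Sketch`, stub 6a)

RADICAL NORMAL FORM / GENERIC SEPARABILITY.  Over a finite field `F` of characteristic `> D`, the
one-variable polynomials `G_l ∈ F[w][t]` (`w = (X_0,…,X_{m-1})`, degree data `≤ D`) of a normal form
`T = {w : ⋀_l ∃t G_l(w,t)=0}` may be replaced, without changing any of the sets `{w : ∃t G_l(w,t)=0}`,
by polynomials `S_l` (the radical of `G_l` in the UFD `F[w][t]`, or `t` when `G_l = 0`) such that off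
the zero set `E` of one nonzero polynomial `B ∈ F[w]` of bounded degree EVERY `F`-rational root of
`t ↦ S_l(w,t)` is simple.  Ingredients: Gauss's lemma (a prime of `F[w][t]` of positive `t`-degree is
primitive, hence irreducible over `F(w)`), separability of irreducible polynomials of degree `< char F`,
the resultant `Res_t(S_l, ∂_t S_l) ∈ F[w]` (nonzero by separability over `F(w)`; Bézout identity
`a S + b S' = Res`, which specialises), a Leibniz bound for its total degree, and Schwartz–Zippel for
`|E| ≤ deg B · |F|^{m-1}`.
-/

set_option linter.dupNamespace false

open Polynomial

namespace Summit.MatrixMultiplication.MatrixMultiplication.Theorems.HexagonClearanceR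

namespace Radical

/-! ## §1 Squarefree polynomials over a UFD are separable over its fraction field (small degree) -/

section UFD

variable {R : Type*} [CommRing R] [IsDomain R] [UniqueFactorizationMonoid R]

omit [UniqueFactorizationMonoid R] in
/-- A prime of `R[X]` of positive degree is primitive (a constant divisor `C r` would be a proper
non-unit factor). -/
theorem isPrimitive_of_prime {p : R[X]} (hp : Prime p) (hd : 0 < p.natDegree) : p.IsPrimitive := by
  rw [Polynomial.isPrimitive_iff_isUnit_of_C_dvd]
  intro r hr
  obtain ⟨q, hq⟩ := hr
  have hp0 : p ≠ 0 := hp.ne_zero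
  rcases hp.irreducible.isUnit_or_isUnit hq with hu | hu
  · exact Polynomial.isUnit_C.1 hu
  · exfalso
    obtain ⟨s, hs, hsq⟩ := Polynomial.isUnit_iff.1 hu
    have : p.natDegree = 0 := by
      rw [hq, ← hsq, ← C_mul, natDegree_C]
    omega

variable {K : Type*} [Field K] [Algebra R K] [IsFractionRing R K]

omit [UniqueFactorizationMonoid R] in
/-- Clearing denominators: if a prime `p ∈ R[X]` of positive degree does not divide `a` in `R[X]`, its
image does not divide the image of `a` over the fraction field. -/
theorem not_map_dvd_map {p a : R[X]} (hp : Prime p) (hd : 0 < p.natDegree) (hpa : ¬ p ∣ a) :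
    ¬ p.map (algebraMap R K) ∣ a.map (algebraMap R K) := by
  rintro ⟨h, hh⟩
  obtain ⟨b, hbM, hb⟩ := IsLocalization.integerNormalization_spec (nonZeroDivisors R) h
  set h₀ := IsLocalization.integerNormalization (nonZeroDivisors R) h with hh₀
  have hb0 : b ≠ 0 := nonZeroDivisors.ne_zero hbM
  have hinj : Function.Injective (algebraMap R K) := IsFractionRing.injective R K
  -- `C b * a = p * h₀` in `R[X]`
  have key : (C b * a).map (algebraMap R K) = (p * h₀).map (algebraMap R K) := by
    rw [Polynomial.map_mul, Polynomial.map_mul, map_C, hb, hh, Algebra.smul_def,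
      Polynomial.algebraMap_apply]
    ring
  have key' : C b * a = p * h₀ := Polynomial.map_injective _ hinj key
  have hdvd : p ∣ C b * a := ⟨h₀, key'⟩
  rcases hp.dvd_or_dvd hdvd with h1 | h1
  · have hCb : (C b : R[X]) ≠ 0 := by simpa using hb0
    have := Polynomial.natDegree_le_of_dvd h1 hCb
    rw [natDegree_C] at this
    omega
  · exact hpa h1

/-- **Squarefree over a UFD ⇒ separable over the fraction field**, provided every prime factor of
positive degree has nonzero derivative (automatic in characteristic `0` or `>` the degree). -/
theorem separable_map_of_squarefree (S : R[X]) (hS0 : S ≠ 0) (hsq : Squarefree S)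
    (hder : ∀ p : R[X], Prime p → p ∣ S → 0 < p.natDegree → derivative p ≠ 0) :
    (S.map (algebraMap R K)).Separable := by
  have hinj : Function.Injective (algebraMap R K) := IsFractionRing.injective R K
  induction S using UniqueFactorizationMonoid.induction_on_prime with
  | h₁ => exact absurd rfl hS0
  | h₂ x hx =>
    obtain ⟨r, hr, rfl⟩ := Polynomial.isUnit_iff.1 hx
    rw [map_C]
    exact (separable_C _).2 (hr.map _)
  | h₃ a p ha hp ih =>
    have hsqa : Squarefree a := Squarefree.of_mul_right hsq
    have hdera : ∀ q : R[X], Prime q → q ∣ a → 0 < q.natDegree → derivative q ≠ 0 :=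
      fun q hq hqa hqd => hder q hq (dvd_mul_of_dvd_right hqa p) hqd
    have iha := ih ha hsqa hdera
    have hpa : ¬ p ∣ a := by
      intro hpa
      have : p * p ∣ p * a := mul_dvd_mul_left p hpa
      exact hp.not_unit (hsq p this)
    rw [Polynomial.map_mul]
    by_cases hdeg : p.natDegree = 0
    · -- `p = C c` is a unit over `K`
      obtain ⟨c, hc⟩ : ∃ c, p = C c := ⟨p.coeff 0, Polynomial.eq_C_of_natDegree_eq_zero hdeg⟩
      have hc0 : c ≠ 0 := by rintro rfl; exact hp.ne_zero (by simp [hc])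
      have hk : algebraMap R K c ≠ 0 := (map_ne_zero_iff _ hinj).2 hc0
      rw [hc, map_C]
      refine ((separable_C _).2 hk.isUnit).mul iha ⟨C (algebraMap R K c)⁻¹, 0, ?_⟩
      rw [zero_mul, add_zero, ← C_mul, inv_mul_cancel₀ hk, C_1]
    · have hd : 0 < p.natDegree := Nat.pos_of_ne_zero hdeg
      have hprim : p.IsPrimitive := isPrimitive_of_prime hp hd
      have hirr : Irreducible (p.map (algebraMap R K)) :=
        (hprim.irreducible_iff_irreducible_map_fraction_map (K := K)).1 hp.irreducible
      have hsep : (p.map (algebraMap R K)).Separable := by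
        rw [Polynomial.separable_iff_derivative_ne_zero hirr, derivative_map]
        intro h0
        apply hder p hp (dvd_mul_right p a) hd
        exact Polynomial.map_injective _ hinj (by rw [h0, Polynomial.map_zero])
      have hcop : IsCoprime (p.map (algebraMap R K)) (a.map (algebraMap R K)) :=
        (hirr.coprime_iff_not_dvd).2 (not_map_dvd_map hp hd hpa)
      exact hsep.mul iha hcop

/-- **The resultant with the derivative is nonzero** for a squarefree `S ∈ R[X]` of degree `d ≥ 1` with
`d ≠ 0` in `R` whose prime factors of positive degree have nonzero derivative: over the fraction field
`S` is separable of degree `d` with derivative of degree `d - 1`, so `Res_{d,d-1}(S, S') ≠ 0` there, and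
the resultant commutes with the (injective) localisation map. -/
theorem resultant_derivative_ne_zero (S : R[X]) (hsq : Squarefree S) (hd : 0 < S.natDegree)
    (hdR : (S.natDegree : R) ≠ 0)
    (hder : ∀ p : R[X], Prime p → p ∣ S → 0 < p.natDegree → derivative p ≠ 0) :
    resultant S (derivative S) S.natDegree (S.natDegree - 1) ≠ 0 := by
  let K := FractionRing R
  have hinj : Function.Injective (algebraMap R K) := IsFractionRing.injective R K
  have hS0 : S ≠ 0 := by rintro rfl; simp at hd
  have hsep : (S.map (algebraMap R K)).Separable := separable_map_of_squarefree S hS0 hsq hder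
  set d := S.natDegree with hddef
  have hdeg1 : (S.map (algebraMap R K)).natDegree = d := natDegree_map_eq_of_injective hinj S
  have hlc : (S.map (algebraMap R K)).coeff d ≠ 0 := by
    rw [coeff_map]
    exact (map_ne_zero_iff _ hinj).2 (leadingCoeff_ne_zero.2 hS0)
  have hdK : (d : K) ≠ 0 := by
    have : algebraMap R K (d : R) ≠ 0 := (map_ne_zero_iff _ hinj).2 hdR
    simpa using this
  have hdeg2 : (derivative (S.map (algebraMap R K))).natDegree = d - 1 := by
    refine le_antisymm ((natDegree_derivative_le _).trans (by rw [hdeg1])) ?_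
    refine le_natDegree_of_ne_zero ?_
    rw [coeff_derivative]
    obtain ⟨d', hd'⟩ : ∃ d', d = d' + 1 := ⟨d - 1, by omega⟩
    have hcast : ((d - 1 : ℕ) : K) + 1 = (d : K) := by
      rw [hd']; push_cast; ring
    rw [show d - 1 + 1 = d by omega, hcast]
    exact mul_ne_zero hlc hdK
  have key : (S.map (algebraMap R K)).resultant (derivative (S.map (algebraMap R K))) ≠ 0 := by
    rw [Ne, resultant_eq_zero_iff]
    push Not
    intro _
    exact (separable_def _).1 hsep
  have key2 : (S.map (algebraMap R K)).resultant ((derivative S).map (algebraMap R K)) d (d - 1) ≠ 0 := by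
    rw [← derivative_map, ← hdeg2, ← hdeg1]
    exact key
  rw [resultant_map_map] at key2
  exact fun h => key2 (by rw [h, map_zero])

end UFD

/-! ## §2 Specialisation: simple roots off the zero set of the resultant -/

section Specialise

variable {F : Type*} [Field F] {m : ℕ}

/-- If `Res_{d,d-1}(S, S')` does not vanish at `w`, every `F`-rational root of `t ↦ S(w, t)` is simple
(Bézout identity `S a + S' b = Res`, specialised at `w` and evaluated at the root). -/
theorem eval_derivative_ne_zero_of_resultant (S : Polynomial (MvPolynomial (Fin m) F)) {d : ℕ}
    (hSd : S.natDegree ≤ d) (hd : d ≠ 0) (w : Fin m → F)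
    (hres : MvPolynomial.eval w (resultant S (derivative S) d (d - 1)) ≠ 0) (t : F)
    (ht : Polynomial.eval t (S.map (MvPolynomial.eval w)) = 0) :
    Polynomial.eval t (derivative (S.map (MvPolynomial.eval w))) ≠ 0 := by
  obtain ⟨a, b, -, -, hab⟩ := exists_mul_add_mul_eq_C_resultant S (derivative S) hSd
    ((natDegree_derivative_le S).trans (Nat.sub_le_sub_right hSd 1)) (Or.inl hd)
  have hmap := congrArg (Polynomial.map (MvPolynomial.eval w)) hab
  rw [Polynomial.map_add, Polynomial.map_mul, Polynomial.map_mul, map_C] at hmap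
  have heval := congrArg (Polynomial.eval t) hmap
  rw [eval_add, eval_mul, eval_mul, eval_C, ht, zero_mul, zero_add, ← derivative_map] at heval
  intro h0
  rw [h0, zero_mul] at heval
  exact hres heval.symm

/-- In characteristic `p > n > 0` the natural number `n` is nonzero in `F[w]`. -/
theorem natCast_ne_zero_of_lt_ringChar {n : ℕ} (hn : 0 < n) (hlt : n < ringChar F) :
    (n : MvPolynomial (Fin m) F) ≠ 0 := by
  have hF : (n : F) ≠ 0 := by
    intro h
    rw [ringChar.spec] at h
    exact absurd (Nat.le_of_dvd hn h) (not_le.2 hlt)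
  intro h
  apply hF
  have := congrArg MvPolynomial.constantCoeff h
  simpa using this

/-- Derivatives of polynomials of degree `0 < n < char F` over `F[w]` are nonzero. -/
theorem derivative_ne_zero_of_natDegree_lt (p : Polynomial (MvPolynomial (Fin m) F))
    (hp : 0 < p.natDegree) (hlt : p.natDegree < ringChar F) : derivative p ≠ 0 := by
  intro h
  have hc := congrArg (fun q => q.coeff (p.natDegree - 1)) h
  simp only [coeff_derivative, coeff_zero] at hc
  rw [show p.natDegree - 1 + 1 = p.natDegree by omega] at hc
  have hlc : p.coeff p.natDegree ≠ 0 := leadingCoeff_ne_zero.2 (by rintro rfl; simp at hp)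
  have hn : ((p.natDegree - 1 : ℕ) : MvPolynomial (Fin m) F) + 1 ≠ 0 := by
    have := natCast_ne_zero_of_lt_ringChar (m := m) (F := F) hp hlt
    obtain ⟨d', hd'⟩ : ∃ d', p.natDegree = d' + 1 := ⟨p.natDegree - 1, by omega⟩
    rw [hd'] at this ⊢
    push_cast at this
    simpa using this
  exact mul_ne_zero hlc hn hc

end Specialise

/-! ## §3 The radical: same zero sets, bounded degrees -/

section RadicalFacts

variable {F : Type*} [Field F] {m : ℕ}

/-- Zero sets agree along the fibres: if `S ∣ G` and `G ∣ S ^ n` in `F[w][t]` then for every `w`,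
`t ↦ G(w,t)` and `t ↦ S(w,t)` have the same `F`-rational zeros (existence form). -/
theorem exists_root_iff_of_dvd_of_dvd_pow {G S : Polynomial (MvPolynomial (Fin m) F)} {n : ℕ}
    (h1 : S ∣ G) (h2 : G ∣ S ^ n) (w : Fin m → F) :
    (∃ t : F, Polynomial.eval t (G.map (MvPolynomial.eval w)) = 0) ↔
      (∃ t : F, Polynomial.eval t (S.map (MvPolynomial.eval w)) = 0) := by
  obtain ⟨u, hu⟩ := h1
  obtain ⟨v, hv⟩ := h2
  constructor
  · rintro ⟨t, ht⟩
    refine ⟨t, ?_⟩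
    have := congrArg (fun P => Polynomial.eval t (P.map (MvPolynomial.eval w))) hv
    simp only [Polynomial.map_mul, Polynomial.map_pow, eval_mul, eval_pow, ht, zero_mul] at this
    exact (pow_eq_zero_iff'.1 this.symm.symm).1
  · rintro ⟨t, ht⟩
    refine ⟨t, ?_⟩
    rw [hu, Polynomial.map_mul, eval_mul, ht, zero_mul]

/-- Total degree of the image of a one-variable polynomial over `F[X_0..X_{m-1}]` in `F[X_0..X_m]` under
`finSuccEquiv.symm`: at most `natDegree + max coefficient degree`. -/
theorem totalDegree_finSuccEquiv_symm_le (P : Polynomial (MvPolynomial (Fin m) F)) {D₁ D₂ : ℕ}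
    (h1 : P.natDegree ≤ D₁) (h2 : ∀ k, (P.coeff k).totalDegree ≤ D₂) :
    ((MvPolynomial.finSuccEquiv F m).symm P).totalDegree ≤ D₂ + D₁ := by
  set f := (MvPolynomial.finSuccEquiv F m).symm P with hf
  have hPf : MvPolynomial.finSuccEquiv F m f = P := (MvPolynomial.finSuccEquiv F m).apply_symm_apply P
  rw [MvPolynomial.totalDegree]
  refine Finset.sup_le fun s hs => ?_
  have hs' : Finsupp.cons (s 0) s.tail = s := Finsupp.cons_tail s
  have hmem : s.tail ∈ ((MvPolynomial.finSuccEquiv F m f).coeff (s 0)).support := by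
    rw [MvPolynomial.mem_support_coeff_finSuccEquiv, hs']; exact hs
  rw [hPf] at hmem
  have hk : s 0 ≤ D₁ := by
    by_contra hlt
    push Not at hlt
    have : P.coeff (s 0) = 0 := Polynomial.coeff_eq_zero_of_natDegree_lt (lt_of_le_of_lt h1 hlt)
    rw [this, MvPolynomial.support_zero] at hmem
    simp at hmem
  have htail : (s.tail.sum fun _ e => e) ≤ D₂ :=
    (MvPolynomial.le_totalDegree hmem).trans (h2 _)
  calc (s.sum fun _ e => e) = (Finsupp.cons (s 0) s.tail).sum (fun _ e => e) := by rw [hs']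
    _ = s 0 + s.tail.sum (fun _ e => e) := by rw [Finsupp.sum_cons]
    _ ≤ D₁ + D₂ := add_le_add hk htail
    _ = D₂ + D₁ := add_comm _ _

/-- Coefficient degrees of a divisor: if `S ∣ G ≠ 0` in `F[w][t]` with `natDegree G ≤ D` and all
coefficients of `G` of total degree `≤ D`, then all coefficients of `S` have total degree `≤ 2 D`
(pass to `F[X_0..X_m]`, where the total degree of a divisor is at most that of the dividend). -/
theorem totalDegree_coeff_le_of_dvd {G S : Polynomial (MvPolynomial (Fin m) F)} (hG0 : G ≠ 0)
    (hSG : S ∣ G) {D : ℕ} (h1 : G.natDegree ≤ D) (h2 : ∀ k, (G.coeff k).totalDegree ≤ D) (k : ℕ) :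
    (S.coeff k).totalDegree ≤ 2 * D := by
  set e := MvPolynomial.finSuccEquiv F m with he
  have hg : (e.symm G).totalDegree ≤ D + D := totalDegree_finSuccEquiv_symm_le G h1 h2
  have hdvd : e.symm S ∣ e.symm G := map_dvd e.symm hSG
  have hg0 : e.symm G ≠ 0 := (map_ne_zero_iff e.symm e.symm.injective).2 hG0
  have hs : (e.symm S).totalDegree ≤ D + D :=
    (MvPolynomial.totalDegree_le_of_dvd_of_isDomain hdvd hg0).trans hg
  have hSe : e (e.symm S) = S := e.apply_symm_apply S
  by_cases hk : (e (e.symm S)).coeff k = 0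
  · rw [hSe] at hk; rw [hk, MvPolynomial.totalDegree_zero]; exact Nat.zero_le _
  · have := MvPolynomial.totalDegree_coeff_finSuccEquiv_add_le (e.symm S) k hk
    rw [hSe] at this
    omega

end RadicalFacts


/-! ## §4 A Leibniz bound for the total degree of the resultant -/

section ResultantDegree

variable {F : Type*} [Field F] {m : ℕ}

/-- Every entry of a Sylvester matrix is `0` or a coefficient of one of the two polynomials. -/
theorem sylvester_entry_induction {R : Type*} [CommRing R] (f g : R[X]) (a b : ℕ) (P : R → Prop)
    (h0 : P 0) (hf : ∀ k, P (f.coeff k)) (hg : ∀ k, P (g.coeff k)) (i j : Fin (a + b)) :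
    P (sylvester f g a b i j) := by
  rw [sylvester, Matrix.of_apply]
  refine Fin.addCases (fun j₁ => ?_) (fun j₁ => ?_) j
  · rw [Fin.addCases_left]
    split_ifs
    · exact hg _
    · exact h0
  · rw [Fin.addCases_right]
    split_ifs
    · exact hf _
    · exact h0

/-- Leibniz bound: if every entry of an `N × N` matrix over `F[w]` has total degree `≤ B`, its
determinant has total degree `≤ N * B`. -/
theorem totalDegree_det_le {N : ℕ} (M : Matrix (Fin N) (Fin N) (MvPolynomial (Fin m) F)) {B : ℕ}
    (hM : ∀ i j, (M i j).totalDegree ≤ B) : M.det.totalDegree ≤ N * B := by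
  rw [Matrix.det_apply]
  refine MvPolynomial.totalDegree_finsetSum_le fun σ _ => ?_
  have hprod : (∏ i, M (σ i) i).totalDegree ≤ N * B := by
    refine (MvPolynomial.totalDegree_finsetProd _ _).trans ?_
    calc ∑ i, (M (σ i) i).totalDegree ≤ ∑ _i : Fin N, B := Finset.sum_le_sum fun i _ => hM _ _
      _ = N * B := by simp
  rcases Int.units_eq_one_or (Equiv.Perm.sign σ) with h | h
  · rw [h, one_smul]; exact hprod
  · rw [h, Units.neg_smul, one_smul, MvPolynomial.totalDegree_neg]; exact hprod

/-- The resultant `Res_{a,b}(f, g)` of one-variable polynomials over `F[w]` whose coefficients have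
total degree `≤ B` has total degree `≤ (a + b) * B`. -/
theorem totalDegree_resultant_le (f g : Polynomial (MvPolynomial (Fin m) F)) (a b : ℕ) {B : ℕ}
    (hf : ∀ k, (f.coeff k).totalDegree ≤ B) (hg : ∀ k, (g.coeff k).totalDegree ≤ B) :
    (resultant f g a b).totalDegree ≤ (a + b) * B := by
  rw [resultant]
  refine totalDegree_det_le _ fun i j => ?_
  exact sylvester_entry_induction f g a b (fun x => x.totalDegree ≤ B)
    (by rw [MvPolynomial.totalDegree_zero]; exact Nat.zero_le _) hf hg i j

/-- Coefficients of the derivative have no larger total degree. -/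
theorem totalDegree_coeff_derivative_le (f : Polynomial (MvPolynomial (Fin m) F)) {B : ℕ}
    (hf : ∀ k, (f.coeff k).totalDegree ≤ B) (k : ℕ) : ((derivative f).coeff k).totalDegree ≤ B := by
  rw [coeff_derivative]
  refine (MvPolynomial.totalDegree_mul _ _).trans ?_
  have : ((k : MvPolynomial (Fin m) F) + 1).totalDegree = 0 := by
    have h : ((k : MvPolynomial (Fin m) F) + 1) = MvPolynomial.C ((k : F) + 1) := by simp
    rw [h, MvPolynomial.totalDegree_C]
  rw [this, add_zero]
  exact hf _

end ResultantDegree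

/-! ## §5 Schwartz–Zippel: the zero set of a nonzero polynomial in `F^m` -/

section Counting

variable {F : Type*} [Field F] [Fintype F] [DecidableEq F] {m : ℕ}

/-- A nonzero `B ∈ F[X_0..X_{m-1}]` has at most `deg B · |F|^{m-1}` zeros in `F^m` (real form). -/
theorem card_zeros_le (B : MvPolynomial (Fin m) F) (hB : B ≠ 0) :
    ((Finset.univ.filter fun w : Fin m → F => MvPolynomial.eval w B = 0).card : ℝ) ≤
      B.totalDegree * (Fintype.card F : ℝ) ^ ((m : ℝ) - 1) := by
  have h := MvPolynomial.schwartz_zippel_totalDegree hB (Finset.univ : Finset F)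
  rw [Fintype.piFinset_univ, Finset.card_univ,
    div_le_div_iff₀ (by positivity) (by positivity)] at h
  -- `h : card * q ≤ deg * q ^ m` in `ℚ≥0`; move to `ℕ`, then to `ℝ`
  have h' : (Finset.univ.filter fun w : Fin m → F => MvPolynomial.eval w B = 0).card *
      Fintype.card F ≤ B.totalDegree * Fintype.card F ^ m := by exact_mod_cast h
  have hq : (0 : ℝ) < Fintype.card F := by exact_mod_cast Fintype.card_pos
  have h'' : ((Finset.univ.filter fun w : Fin m → F => MvPolynomial.eval w B = 0).card : ℝ) *
      Fintype.card F ≤ B.totalDegree * (Fintype.card F : ℝ) ^ (m : ℝ) := by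
    rw [Real.rpow_natCast]; exact_mod_cast h'
  rw [Real.rpow_sub hq, Real.rpow_one, mul_div_assoc', le_div_iff₀ hq]
  exact h''

end Counting


end Radical

/-- **Generic separability (registered helper of stub 6a).**  For a squarefree one-variable polynomial
`S` over a UFD `R` of degree `d ≥ 1` with `d ≠ 0` in `R`, all of whose prime factors of positive
degree have nonzero derivative, the resultant `Res_{d,d-1}(S, S')` is nonzero. -/
theorem radical_resultant_derivative_ne_zero {R : Type*} [CommRing R] [IsDomain R]
    [UniqueFactorizationMonoid R] (S : Polynomial R) (hsq : Squarefree S) (hd : 0 < S.natDegree)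
    (hdR : (S.natDegree : R) ≠ 0)
    (hder : ∀ p : Polynomial R, Prime p → p ∣ S → 0 < p.natDegree → Polynomial.derivative p ≠ 0) :
    Polynomial.resultant S (Polynomial.derivative S) S.natDegree (S.natDegree - 1) ≠ 0 :=
  Radical.resultant_derivative_ne_zero S hsq hd hdR hder

end Summit.MatrixMultiplication.MatrixMultiplication.Theorems.HexagonClearanceR
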